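import Mathlib.Combinatorics.SimpleGraph.Basic
import Mathlib.Data.Sym.Card
import Mathlib.Data.Nat.Choose.Cast
import Mathlib.Data.Fintype.EquivFin
import Mathlib.Analysis.SpecialFunctions.Pow.Real
import Literature.Computability.QuantumComplexity.SingletonSensitivityQueryBound

/-!
# Graph completeness from adjacency queries needs `Ω(n)` quantum queries (DEQ-A168)

Cell pub-qadeq, register row A-168 / §1 OPEN-56 (lead-filed note `DEQ-A168.md`). Honest framing:
instance-level adjudication of specific advantage claims; no claim about BQP vs BPP or the summit.

S. Giordano, M. A. Martin-Delgado, *Quantum algorithm for testing graph completeness*, Annals of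
Physics 484 (2026) 170305 (arXiv:2407.20069) claim an algorithm which "takes the number of nodes
and the adjacency matrix as input" and decides completeness in "time complexity `O(log² n)` …
offering a clear quantum advantage over classical methods" (abstract), the classical comparator
being "the number of steps required to check all the links in a graph, which is `O(n²)`" (§3.2).

This file records the query-complexity floor that any such algorithm must respect when the graph
is PRESENTED BY ITS ADJACENCY BITS (the standard black-box / query reading of "the adjacency
matrix as input"):

* `EdgeSlot n` — the `n(n-1)/2` unordered pairs of distinct vertices (`card_edgeSlot`), numbered
  by any bijection `e : Fin N ≃ EdgeSlot n` (`nonempty_numbering` : one exists for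
  `N = n.choose 2`); `graphOfBits e x` — the simple graph on `Fin n` whose edges are the slots
  whose bit is set; `graphOfBits_eq_top_iff` — it is the complete graph iff EVERY bit is set, i.e.
  iff `andFn N x = true`, for every numbering `e`.  So "is the presented graph complete?" is, as
  a Boolean function of the query bits, exactly `AND_N` with `N = n(n-1)/2`.
* `completeness_query_floor` — `√(n(n-1)/2) ≤ 4 · Q₂(AND_{n(n-1)/2})`: every quantum algorithm
  that decides completeness with error ≤ 1/3 from adjacency queries makes at least
  `√(n(n-1)/2)/4 ≥ (n-1)/(4√2)` queries (`completeness_query_floor_linear`) — Beals–Buhrman–Cleve–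
  Mosca–de Wolf 2001 Thm 4.13 (PROVED in the tree) via
  `Literature.Computability.QuantumComplexity.sqrt_le_four_mul_quantumQueryComplexity_andFn`.
* `floor_exceeds_log_sq_4096` — the floor is not `O(log² n)`: already at `n = 4096` it is
  `≥ 723 > 144 = (log₂ n)²` (and the ratio grows like `n / log² n`).

What is NOT claimed here: nothing about the gate cost of the paper's circuit GIVEN a block-box
walk operator `W_P` (then the input is the operator, not the adjacency matrix); nothing about
classical property testing beyond the remark in the note; no statement about BQP vs BPP.
-/

namespace Summit.QuantumAdvantage.Dequantization.GraphCompletenessQueryFloor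

open Literature.Computability.QuantumComplexity Literature.Computability.Cryptography
  Literature.Computability.Complexity

variable {n N : ℕ}

/-! ### Graphs presented by adjacency bits -/

/-- The edge slots of an `n`-vertex simple graph: unordered pairs of DISTINCT vertices
(the strictly-upper-triangular positions of the adjacency matrix). -/
abbrev EdgeSlot (n : ℕ) : Type := {s : Sym2 (Fin n) // ¬s.IsDiag}

/-- There are `n(n-1)/2 = n.choose 2` edge slots. -/
theorem card_edgeSlot (n : ℕ) : Fintype.card (EdgeSlot n) = n.choose 2 := by
  rw [Sym2.card_subtype_not_diag, Fintype.card_fin]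

/-- A numbering of the edge slots by `Fin (n.choose 2)` exists (any fixed layout of the
adjacency bits, e.g. row-major upper triangle, is one). -/
theorem nonempty_numbering (n : ℕ) : Nonempty (Fin (n.choose 2) ≃ EdgeSlot n) :=
  ⟨(Fintype.equivFinOfCardEq (card_edgeSlot n)).symm⟩

/-- The simple graph on `Fin n` presented by the bit vector `x` under the numbering `e`:
`{v, w}` is an edge iff the bit of its slot is set. -/
def graphOfBits (e : Fin N ≃ EdgeSlot n) (x : Fin N → Bool) : SimpleGraph (Fin n) :=
  SimpleGraph.fromEdgeSet {s | ∃ h : ¬s.IsDiag, x (e.symm ⟨s, h⟩) = true}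

/-- Adjacency in the presented graph: `v ~ w` iff `v ≠ w` and the bit of slot `{v, w}` is set. -/
theorem graphOfBits_adj (e : Fin N ≃ EdgeSlot n) (x : Fin N → Bool) (v w : Fin n) :
    (graphOfBits e x).Adj v w ↔
      ∃ h : v ≠ w, x (e.symm ⟨s(v, w), by rwa [Sym2.mk_isDiag_iff]⟩) = true := by
  unfold graphOfBits
  rw [SimpleGraph.fromEdgeSet_adj, Set.mem_setOf_eq]
  constructor
  · rintro ⟨⟨h, hx⟩, hvw⟩
    exact ⟨hvw, hx⟩
  · rintro ⟨hvw, hx⟩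
    exact ⟨⟨by rwa [Sym2.mk_isDiag_iff], hx⟩, hvw⟩

/-- **The presented graph is complete iff every adjacency bit is set** — for EVERY numbering `e`
of the slots.  Hence, as a Boolean function of the `N` query bits, "is the graph complete?" is
`AND_N` (`Literature.Computability.QuantumComplexity.andFn`). -/
theorem graphOfBits_eq_top_iff (e : Fin N ≃ EdgeSlot n) (x : Fin N → Bool) :
    graphOfBits e x = ⊤ ↔ andFn N x = true := by
  rw [andFn_eq_true_iff, SimpleGraph.eq_top_iff_forall_ne_adj]
  constructor
  · intro h k
    obtain ⟨⟨s, hs⟩, hk⟩ : ∃ t : EdgeSlot n, e.symm t = k := ⟨e k, e.symm_apply_apply k⟩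
    induction s using Sym2.ind with
    | h v w =>
      have hvw : v ≠ w := by rwa [Sym2.mk_isDiag_iff] at hs
      obtain ⟨_, hx⟩ := (graphOfBits_adj e x v w).1 (h v w hvw)
      rwa [hk] at hx
  · intro h v w hvw
    exact (graphOfBits_adj e x v w).2 ⟨hvw, h _⟩

/-- The completeness predicate of the presented graph, as a Boolean function of the adjacency
bits (independent of the numbering, by `graphOfBits_eq_top_iff`). -/
def completeFn (N : ℕ) : (Fin N → Bool) → Bool := andFn N

/-- `completeFn` decides completeness of the presented graph. -/
theorem completeFn_eq_true_iff (e : Fin N ≃ EdgeSlot n) (x : Fin N → Bool) :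
    completeFn N x = true ↔ graphOfBits e x = ⊤ :=
  (graphOfBits_eq_top_iff e x).symm

/-! ### The query floor -/

/-- **Query floor for graph completeness.** Every bounded-error (error ≤ 1/3) quantum query
algorithm deciding whether an `n`-vertex graph presented by its `n(n-1)/2` adjacency bits is
complete makes at least `√(n(n-1)/2) / 4` queries:
`√(n.choose 2) ≤ 4 · Q₂(completeFn (n.choose 2))` (Beals–Buhrman–Cleve–Mosca–de Wolf 2001,
Thm 4.13, via the tree's `sqrt_le_four_mul_quantumQueryComplexity_andFn`). -/
theorem completeness_query_floor (n : ℕ) :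
    Real.sqrt (n.choose 2 : ℕ) ≤
      4 * (quantumQueryComplexity (1 / 3) (completeFn (n.choose 2)) : ℝ) :=
  sqrt_le_four_mul_quantumQueryComplexity_andFn (n.choose 2)

/-- `(n-1)/√2 ≤ √(n(n-1)/2)` for `n ≥ 1`. -/
theorem sub_one_div_sqrt_two_le_sqrt_choose (n : ℕ) (hn : 1 ≤ n) :
    ((n : ℝ) - 1) / Real.sqrt 2 ≤ Real.sqrt (n.choose 2 : ℕ) := by
  have hcast : ((n.choose 2 : ℕ) : ℝ) = (n : ℝ) * ((n : ℝ) - 1) / 2 := Nat.cast_choose_two (K := ℝ) n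
  have hn' : (1 : ℝ) ≤ n := by exact_mod_cast hn
  have h2 : (0 : ℝ) < Real.sqrt 2 := Real.sqrt_pos.2 (by norm_num)
  rw [div_le_iff₀ h2, ← Real.sqrt_mul (by rw [hcast]; nlinarith)]
  apply Real.le_sqrt_of_sq_le
  rw [hcast]
  nlinarith

/-- **Linear form of the floor**: `(n-1)/(4√2) ≤ Q₂(completeFn (n(n-1)/2))` for `n ≥ 1` — the
query count is `Ω(n)`, not polylogarithmic. -/
theorem completeness_query_floor_linear (n : ℕ) (hn : 1 ≤ n) :
    ((n : ℝ) - 1) / (4 * Real.sqrt 2) ≤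
      (quantumQueryComplexity (1 / 3) (completeFn (n.choose 2)) : ℝ) := by
  have h := completeness_query_floor n
  have h' := sub_one_div_sqrt_two_le_sqrt_choose n hn
  have h2 : (0 : ℝ) < Real.sqrt 2 := Real.sqrt_pos.2 (by norm_num)
  rw [div_le_iff₀ (by positivity)]
  rw [div_le_iff₀ h2] at h'
  nlinarith

/-- **The floor is not `O(log² n)`**: at `n = 4096 = 2¹²`, `(log₂ n)² = 144` while the floor
`√(n(n-1)/2)/4` already exceeds `144` (indeed `4 · 144 = 576 < 2895 ≤ √8386560`), so
`Q₂ > 144 = (log₂ 4096)²`. -/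
theorem floor_exceeds_log_sq_4096 :
    (144 : ℝ) < (quantumQueryComplexity (1 / 3) (completeFn (Nat.choose 4096 2)) : ℝ) := by
  have h := completeness_query_floor 4096
  have hc : ((Nat.choose 4096 2 : ℕ) : ℝ) = 8386560 := by norm_num [Nat.choose_two_right]
  rw [hc] at h
  have hs : (576 : ℝ) < Real.sqrt 8386560 := by
    rw [show (576 : ℝ) = Real.sqrt (576 ^ 2) by rw [Real.sqrt_sq (by norm_num)]]
    exact Real.sqrt_lt_sqrt (by norm_num) (by norm_num)
  linarith

/-- `log₂ 4096 = 12`, so `(log₂ 4096)² = 144` (the comparison value used above). -/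
theorem log_two_4096 : Nat.log 2 4096 = 12 := by
  decide

end Summit.QuantumAdvantage.Dequantization.GraphCompletenessQueryFloor
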